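import Literature.NumberTheory.EllipticCurves.Kato2004.IwasawaH2Descent
import Literature.NumberTheory.EllipticCurves.KatoFineSelmerDualProofs
import Literature.NumberTheory.EllipticCurves.IwasawaAlgebraCharIdealProofs
import Literature.NumberTheory.EllipticCurves.IwasawaAlgebraPseudoNullProofs
import HarnessLib

/-!
# Kato 2004 (Astérisque 295): `𝐇²_Γ(T_pW)` CONTAINS the dual fine Selmer group `X₀(E/ℚ_∞)` with finite
# cokernel when `E(ℚ_{p,∞})[p^∞]` is finite (`p` odd) — ONE named fact (the second package announced in
# `Kato2004/IwasawaH2Descent.lean`, "TODO(general form)") and its proved corollary: equal lengths at every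
# height-one prime of `Λ` (the (H2) clause of `Summit…Rank1Residual.Additive.IsKatoZetaDescentDatumOf`)

Topic `NumberTheory/EllipticCurves`, sub-directory `Kato2004` (namespace = path). ONE `def … : Prop` (named
fact, review-queued, net debt +1), theorems otherwise; no instance, no notation, no `sorry`. Seat
`bsd-cm-prr-ty1` (literature-prover, cell `bsd-cm`; stub 4 `stub_realizableOfKMCFine` of the Kato–Perrin-Riou
skeletons on cruxes stmt-BirchSwinnertonDyer-19945 / -19223, residue (ii) «(H2)-lengths»). HONEST FRAMING: BSD is not
advanced by this file; nothing about Kato's Main Conjecture is asserted; the fact is a CONSTRUCTION fact about Kato's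
genuine `𝐇²_Γ(T_pW)` (as `nonempty_iwasawaH2Data` is), never stronger than print (below, SCOPE).

## The printed mechanism (all from Kato's text; read 2026-08-28 in the store copy `paper:doi-10-24033-ast-639`)

Conventions (8.2, p. 180): `H^q(R, ·) := H^q_ét(Spec R, j_* ·)`; `𝐇^q(T) := lim←_n H^q(ℤ[ζ_{p^n}][1/p], T)`
(12.2, p. 220); `𝐇^q_loc(T) := lim←_n H^q(ℚ(ζ_{p^n}) ⊗ ℚ_p, T)`. PRINTED: (12.2.1) `𝐇¹(T)`, `𝐇²(T)` are finitely
generated `ℤ_p[[G_∞]]`-modules; Thm. 12.4 (1) (p. 221) `𝐇²(T)` is torsion (for every stable lattice `T` of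
`V_{F_λ}(f)`, here `T = T_pW`, `f = f_W`); (12.2.3) and the display after it (p. 220): `𝐇²_loc(T)` is finitely
generated with `dim 𝐇²_loc(T)_𝔮 = 0` at height `0`, and "by local Tate duality,
`𝐇²_loc(T) ≅ Hom(H⁰(ℚ_p(ζ_{p^∞}), Hom(T, ℚ/ℤ)), ℚ/ℤ)(−1)`", i.e. for `T = T_pW` (Weil pairing `Hom(T_pW, ℚ/ℤ)(−1)… =
W[p^∞]`): `𝐇²_loc(T_pW) ≅ (W(ℚ_p(ζ_{p^∞}))[p^∞])^∨`; (14.9.1) (p. 239), Poitou–Tate for `K` a number field and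
`T`: `… → H¹(K ⊗ ℚ_p, T) → {H¹(O_K[1/p], T*(1) ⊗ ℚ/ℤ)}^∨ → H²(O_K[1/p], T) → H²(K ⊗ ℚ_p, T) →
{H⁰(O_K[1/p], T*(1) ⊗ ℚ/ℤ)}^∨ → 0`, "exact in the case `p ≠ 2`, and exact upto `×2` in the case `p = 2`";
(17.13.1) (p. 279): Kato passes exactly these sequences to `lim←_n` over `K = ℚ(ζ_{p^n})` (all terms compact);
§13.8 (p. 228) / (14.14.1) (p. 243): `0 → 𝐇¹(T)/𝔭𝐇¹(T) → H¹(ℤ[1/p], T) → 𝐇²(T)[𝔭] → 0`.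
CONSEQUENCE (the cokernel of `H¹(K ⊗ ℚ_p, T) → {H¹(O_K[1/p], T*(1)⊗ℚ/ℤ)}^∨` is, by the local duality displayed on
p. 239, the Pontryagin dual of `ker(H¹(O_K[1/p], W[p^∞]) → H¹(K ⊗ ℚ_p, W[p^∞]))`): for `p ≠ 2`, in the limit
over the layers `ℚ_n` of `ℚ_∞` (the `Δ`-trivial component, READING (i) of `IwasawaH2Descent.lean`), an EXACT
sequence of `Λ`-modules `0 → X₀(ℚ_∞) → 𝐇²_Γ(T_pW) → 𝐇²_{Γ,loc}(T_pW) ≅ (W(ℚ_{p,∞})[p^∞])^∨`, where `ℚ_{p,∞}`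
is the cyclotomic `ℤ_p`-extension of `ℚ_p` and `X₀(ℚ_∞)` is the Pontryagin dual of the classes in
`H¹(ℚ_∞, W[p^∞])` unramified away from `p` and trivial at `p` — which over `ℚ_∞` ARE the everywhere locally
trivial classes `Sel₀(ℚ_∞, W[p^∞])` of the tree (`WeierstrassCurve.fineSelmerInfty`: for `w ∤ p` the residue
field of `ℚ_{∞,w}` has absolute Galois group `∏_{ℓ ≠ p} ℤ_ℓ`, so `H¹_ur(ℚ_{∞,w}, W[p^∞]) = 0`; at `∞`, `p` odd).
HENCE: `X₀(E/ℚ_∞) ↪ 𝐇²_Γ(T_pW)` with cokernel a submodule of `(W(ℚ_{p,∞})[p^∞])^∨` — FINITE as soon as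
`W(ℚ_{p,∞})[p^∞]` is finite. Secondary prints of the same Poitou–Tate mechanism: Kobayashi, Invent. Math. 152
(2003) §7 (supersingular `p`: `E(ℚ_{p,∞})[p] = 0`), Kurihara, Invent. Math. 149 (2002) §1; in `G_S`-cohomology
(local terms at all of `S`): Coates–Sujatha, Math. Ann. 331 (2005) Lemma 3.1, D. Kundu, thesis (Toronto 2020) (2.9)
(store `paper:w3142122693` p. 16) — context only, NOT the statement below (Kato's `j_*`-convention has local terms
at `p` alone).

## SCOPE of the fact (exactly the printed hypotheses; where it says nothing)

* `p ≠ 2` (Kato's (14.9.1) is only "exact up to `×2`" at `p = 2`; the layers of `ℚ_∞` are totally real).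
* `κ` CYCLOTOMIC with topological generator `γ` (the tower of (12.2)/(14.14.1); `Λ = ℤ_p⟦T⟧`, `T = γ − 1`).
* `W(ℚ_{p,∞})[p^∞]` FINITE, stated in the tree's vocabulary as the finiteness of the fixed points of
  `Gal(ℚ̄_p/ℚ_{p,∞}) = ker κ ⊓ D_v` (`ZpExtension.kerSubgroup`, `GreenbergSelmer.decomp v`, `v` the place of `ℚ` at
  `p`; `D_v` is the decomposition group of the tree's chosen prime above `v` — any other choice is conjugate, with
  isomorphic fixed points) on `W(ℚ̄)[p^∞] = W.geomPrimaryTorsion p`. It HOLDS whenever `W` is potentially good at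
  `p` (`0 ≤ v_p(j W)`: Imai, Proc. Japan Acad. 51 (1975) Theorem p. 12, over a field of good reduction — the standing
  hypothesis of every reading in the Kato descent files, all CM rows of 19945/19223) and whenever `W` is
  multiplicative at `p`; it FAILS for `p` odd exactly at `p = 3` with `W/ℚ_3` the `ω`-twist of a Tate curve
  (Kato (12.5.1)/Rem. 12.7, p. 222: there `𝐇²` exceeds `X₀` by length one at one height-one prime) — the fact says
  NOTHING there, and nothing at `p = 2`. The bridge `0 ≤ v_p(j W) ⇒ finite` (Imai + semistable reduction) is NOT part
  of this fact.
* The `Λ`-structure of the abstract `H2` of the witness `J` is the one making the Poitou–Tate injection `Λ`-linear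
  for the tree's convention on `X₀` (`(T·x)(s) = x(conj_γ s) − x(s)`, `FineSelmerDualData.toDual_T_smul`); the fields
  of `IwasawaH2Data` ((12.2.1), 12.4 (1), (14.14.1) on `T`-(co)invariants, the pins of `A` and `ι`) are insensitive
  to `γ ↔ γ⁻¹`, so this is a convention, not a hypothesis.
WEAKER than print (the maps to `𝐇²_{Γ,loc}` and the identity of `H2` are forgotten; only "injective with finite
cokernel" is kept), never stronger. JUNK AUDIT: not vacuous (under its hypotheses it produces a package with (14.14.1)
AND pins the height-one lengths of `H2` to the CONSTRUCTED `X₀ = (W.fineSelmerDualData κ hγ).X`, corollary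
`…lengthAt_eq`; the manufactured package of `IwasawaH2DataOfInjectivityProofs` (`H2` killed by `T`) does not in
general satisfy it); not refutable by cooked data (it is an `∃`); at `p = 2` and at the exceptional `(W, 3)` its
hypotheses are not met (no do-not-display row is covered by accident).

## References

* K. Kato, Astérisque 295 (2004): 8.2 (p. 180), 12.2 (12.2.1)–(12.2.3) and the display after it (p. 220), Thm. 12.4 (1)
  (p. 221), Thm. 12.5 (3) with (12.5.1) and Rem. 12.7 (p. 222), 13.8 (p. 228), (14.9.1) (p. 239), (14.14.1) (p. 243),
  (17.13.1) (p. 279). [Kato2004Asterisque]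
* H. Imai, Proc. Japan Acad. 51 (1975) 12–16, Theorem (p. 12). [Imai1975] (scope remark only)
* R. Greenberg, LNM 1716 (1999) §1; J. Coates, R. Sujatha, Math. Ann. 331 (2005) §3, Lemma 3.1 [CoatesSujatha2005];
  B. Perrin-Riou, Astérisque 229 (1995) §1.3, App. B (= Kato's [Pe3]) [PerrinRiou1995Asterisque] — context.
* Tree: `Kato2004/IwasawaH2Descent.lean` (`IwasawaH2Data`, `nonempty_iwasawaH2Data`, the TODO this file serves),
  `KatoFineSelmerDualProofs.lean` (`WeierstrassCurve.fineSelmerDualData`), `GreenbergSelmer.lean` (`decomp`),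
  `Ribet1981/FiniteTorsionCyclotomic.lean` (the GLOBAL finiteness `E(ℚ_∞)[p^∞]`, a different statement),
  `IwasawaAlgebraCharIdealProofs.lean` / `IwasawaAlgebraPseudoNullProofs.lean` (lengths under pseudo-isomorphism).
-/

noncomputable section

open scoped NumberField
open Field IsDedekindDomain
open Literature.NumberTheory.GaloisRepresentations
open Literature.NumberTheory.EllipticCurves Literature.NumberTheory.EllipticCurves.IwasawaAlgebra
open Literature.NumberTheory.EllipticCurves.Module

namespace Literature.NumberTheory.EllipticCurves.Kato2004

/-! ## Algebra: an injection with finite cokernel preserves lengths at height `≤ 1` -/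

section Algebra

variable {p : ℕ} [Fact p.Prime] {M N : Type*} [AddCommGroup M] [_root_.Module (IwasawaAlgebra p) M]
  [AddCommGroup N] [_root_.Module (IwasawaAlgebra p) N]

/-- Over `Λ = ℤ_p⟦T⟧`, an injective `Λ`-linear map with FINITE cokernel is a pseudo-isomorphism, hence preserves
local lengths at every prime of height `≤ 1` (finite `Λ`-modules are pseudo-null).
[cite: Washington1997, §13.2] [cite: NeukirchSchmidtWingberg2008, Ch. V §1, (5.1.4) Remark 4] -/
theorem lengthAt_eq_of_injective_of_finite_quotient (e : M →ₗ[IwasawaAlgebra p] N)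
    (he : Function.Injective e) (hfin : Finite (N ⧸ LinearMap.range e))
    (𝔮 : PrimeSpectrum (IwasawaAlgebra p)) (h𝔮 : 𝔮.asIdeal.height ≤ 1) :
    lengthAt (IwasawaAlgebra p) M 𝔮 = lengthAt (IwasawaAlgebra p) N 𝔮 := by
  haveI : Subsingleton (LinearMap.ker e) := by
    rw [LinearMap.ker_eq_bot.mpr he]
    infer_instance
  haveI : Finite (LinearMap.ker e) := Finite.of_subsingleton
  haveI := hfin
  exact lengthAt_eq_of_isPseudoIsomorphism
    ⟨isPseudoNull_of_finite p (LinearMap.ker e), isPseudoNull_of_finite p (N ⧸ LinearMap.range e)⟩ 𝔮 h𝔮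

end Algebra

/-! ## The named fact -/

/-- **Kato's `𝐇²_Γ(T_pW)` contains the dual fine Selmer group `X₀(E/ℚ_∞)` with finite cokernel (`p` odd,
`W(ℚ_{p,∞})[p^∞]` finite).** For an elliptic curve `W/ℚ`, an odd prime `p`, the CYCLOTOMIC `ℤ_p`-extension `κ`
with topological generator `γ`, the place `v` of `ℚ` at `p`, under the hypothesis that
`W(ℚ_{p,∞})[p^∞] = (W(ℚ̄)[p^∞])^{ker κ ⊓ D_v}` is finite, and for every pinned Iwasawa cohomology
`I : IwasawaH1Data W p κ γ` (`𝐇¹_Γ(T_pW)`): there is a descent package `J : IwasawaH2Data W p κ γ I` (Kato's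
`𝐇²_Γ(T_pW)`: finitely generated (12.2.1), torsion (Thm. 12.4 (1)), with `H¹(ℤ[1/p], T_pW)` and the exact sequence
(14.14.1) pinned to `proj₀`) TOGETHER WITH an injective `Λ`-linear map from the constructed dual fine Selmer group
`X₀(E/ℚ_∞) = (W.fineSelmerDualData κ hγ).X` into `J.H2` whose cokernel is finite — the limit over the layers `ℚ_n`
of Kato's Poitou–Tate sequence (14.9.1) ("exact in the case `p ≠ 2`") read through the local duality of p. 239 and
`𝐇²_loc(T) ≅ Hom(H⁰(ℚ_p(ζ_{p^∞}), Hom(T, ℚ/ℤ)), ℚ/ℤ)(−1)` (display after (12.2.3)), the passage to the limit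
being Kato's (17.13.1). A CONSTRUCTION fact (review-queued); SCOPE and conventions: module docstring. Nothing is
asserted at `p = 2`, for non-cyclotomic `κ`, or when `W(ℚ_{p,∞})[p^∞]` is infinite (Kato (12.5.1)).
[cite: Kato2004Asterisque, (14.9.1) (p. 239), 12.2 (12.2.1)–(12.2.3) and the display after it (p. 220), Thm. 12.4 (1) (p. 221), 13.8 (p. 228), (14.14.1) (p. 243), (17.13.1) (p. 279)] -/
def exists_iwasawaH2Data_fineSelmerDual_embedding : Prop :=
  ∀ (W : WeierstrassCurve ℚ) [W.IsElliptic] (p : ℕ) [Fact p.Prime] [ContinuousSMul ℤ_[p] (W.tateModule p)]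
    (κ : ZpExtension ℚ p) (γ : absoluteGaloisGroup ℚ) (hγ : κ.IsTopGenerator γ)
    (v : HeightOneSpectrum (𝓞 ℚ)),
    p ≠ 2 → κ.IsCyclotomic → ((Rat.HeightOneSpectrum.primesEquiv v : Nat.Primes) : ℕ) = p →
    Finite (FixedPoints.addSubgroup ↥(κ.kerSubgroup ⊓ GreenbergSelmer.decomp v) (W.geomPrimaryTorsion p)) →
    ∀ I : IwasawaH1Data W p κ γ,
      ∃ (J : IwasawaH2Data W p κ γ I) (e : (W.fineSelmerDualData κ hγ).X →ₗ[IwasawaAlgebra p] J.H2),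
        Function.Injective e ∧ Finite (J.H2 ⧸ LinearMap.range e)

/-! ## Proved corollaries (the consumer shapes) -/

section Corollaries

variable {W : WeierstrassCurve ℚ} [W.IsElliptic] {p : ℕ} [Fact p.Prime] [ContinuousSMul ℤ_[p] (W.tateModule p)]
  {κ : ZpExtension ℚ p} {γ : absoluteGaloisGroup ℚ}

/-- **The (H2)-lengths clause**: under the fact, for `p` odd, `κ` cyclotomic, `W(ℚ_{p,∞})[p^∞]` finite and any pin
`I`, there is a package `J : IwasawaH2Data W p κ γ I` with
`length_{Λ_𝔮} (J.H2)_𝔮 = length_{Λ_𝔮} X₀(E/ℚ_∞)_𝔮` at EVERY height-one prime `𝔮` of `Λ` — verbatim the (H2)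
clause of `Summit.BirchSwinnertonDyer.Rank1Residual.Additive.IsKatoZetaDescentDatumOf` (with `P.κ`, `P.isTopGenerator`,
`P.I`, `P.J`). [cite: Kato2004Asterisque, (14.9.1) (p. 239), Thm. 12.4 (1) (p. 221), (14.14.1) (p. 243)] -/
theorem exists_iwasawaH2Data_fineSelmerDual_embedding.lengthAt_eq
    (h : exists_iwasawaH2Data_fineSelmerDual_embedding) (hγ : κ.IsTopGenerator γ)
    (v : HeightOneSpectrum (𝓞 ℚ)) (hp : p ≠ 2) (hκ : κ.IsCyclotomic)
    (hv : ((Rat.HeightOneSpectrum.primesEquiv v : Nat.Primes) : ℕ) = p)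
    (hfin : Finite (FixedPoints.addSubgroup ↥(κ.kerSubgroup ⊓ GreenbergSelmer.decomp v)
      (W.geomPrimaryTorsion p)))
    (I : IwasawaH1Data W p κ γ) :
    ∃ J : IwasawaH2Data W p κ γ I, ∀ 𝔮 : PrimeSpectrum (IwasawaAlgebra p), 𝔮.asIdeal.height = 1 →
      lengthAt (IwasawaAlgebra p) J.H2 𝔮 = lengthAt (IwasawaAlgebra p) (W.fineSelmerDualData κ hγ).X 𝔮 := by
  obtain ⟨J, e, he, hfin'⟩ := h W p κ γ hγ v hp hκ hv hfin I
  exact ⟨J, fun 𝔮 h𝔮 => (lengthAt_eq_of_injective_of_finite_quotient e he hfin' 𝔮 h𝔮.le).symm⟩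

/-- **Equal characteristic ideals**: under the fact (same hypotheses) some package `J` has
`char_Λ(J.H2) = char_Λ(X₀(E/ℚ_∞))` (`FineSelmerDualData.charIdeal` is `Module.charIdeal` of `X`).
[cite: Kato2004Asterisque, (14.9.1) (p. 239), Thm. 12.4 (1) (p. 221)] [cite: Washington1997, §13.2] -/
theorem exists_iwasawaH2Data_fineSelmerDual_embedding.charIdeal_eq
    (h : exists_iwasawaH2Data_fineSelmerDual_embedding) (hγ : κ.IsTopGenerator γ)
    (v : HeightOneSpectrum (𝓞 ℚ)) (hp : p ≠ 2) (hκ : κ.IsCyclotomic)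
    (hv : ((Rat.HeightOneSpectrum.primesEquiv v : Nat.Primes) : ℕ) = p)
    (hfin : Finite (FixedPoints.addSubgroup ↥(κ.kerSubgroup ⊓ GreenbergSelmer.decomp v)
      (W.geomPrimaryTorsion p)))
    (I : IwasawaH1Data W p κ γ) :
    ∃ J : IwasawaH2Data W p κ γ I,
      charIdeal (IwasawaAlgebra p) J.H2 = charIdeal (IwasawaAlgebra p) (W.fineSelmerDualData κ hγ).X := by
  obtain ⟨J, hJ⟩ := h.lengthAt_eq hγ v hp hκ hv hfin I
  refine ⟨J, ?_⟩
  unfold charIdeal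
  exact finprod_mem_congr rfl fun 𝔮 h𝔮 => by rw [hJ 𝔮 h𝔮]

/-- **In scope the package exists** (the conclusion of `nonempty_iwasawaH2Data` for `p` odd, `κ` cyclotomic,
`W(ℚ_{p,∞})[p^∞]` finite, from this fact). [cite: Kato2004Asterisque, (12.2.1) (p. 220), Thm. 12.4 (1) (p. 221), (14.14.1) (p. 243)] -/
theorem exists_iwasawaH2Data_fineSelmerDual_embedding.nonempty
    (h : exists_iwasawaH2Data_fineSelmerDual_embedding) (hγ : κ.IsTopGenerator γ)
    (v : HeightOneSpectrum (𝓞 ℚ)) (hp : p ≠ 2) (hκ : κ.IsCyclotomic)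
    (hv : ((Rat.HeightOneSpectrum.primesEquiv v : Nat.Primes) : ℕ) = p)
    (hfin : Finite (FixedPoints.addSubgroup ↥(κ.kerSubgroup ⊓ GreenbergSelmer.decomp v)
      (W.geomPrimaryTorsion p)))
    (I : IwasawaH1Data W p κ γ) : Nonempty (IwasawaH2Data W p κ γ I) := by
  obtain ⟨J, -⟩ := h W p κ γ hγ v hp hκ hv hfin I
  exact ⟨J⟩

end Corollaries

end Literature.NumberTheory.EllipticCurves.Kato2004

end
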